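import Mathlib
import HarnessLib
import Summits.HubbardSuperconductivity.HubbardSuperconductivity.Theorems.KLProgrammeH10TwoPointLimitPerturbedCountPairs
import Summits.HubbardSuperconductivity.HubbardSuperconductivity.Theorems.KLProgrammeH10TwoPointLimitPerturbedCell

/-!
# Route `KLProgramme` — crux K1 `H10TwoPointLimit` (stmt-HubbardSuperconductivity-19938):
# the sector count modulo `2πℤ²` against an arbitrary momentum offset ON THE PERTURBED FERMI CURVE (Cor. F.3 on the moving curve)

Row (E) of HOME/prover-p4/SECTOR-COUNTING-INTERFACE.md on BGM's moving curve at ALL scales (GAP-LEDGER G-002 closer (i); the lineage's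
`offsetSectorCount_slack` — DECOMP App. F Cor. F.3 = BGM 2006 (2.76)/(2.80) for all numbers of legs — for the `E`-shells `|ε₀(k) + δ(k) - μ| ≤ π/2ⁿ`
of a `C²`, even, `2πℤ²`-periodic perturbation `δ`): for every level window `[μ₁, μ₂] ⊂ (-4, 0)` and slack `c ≥ 0` there are `κ > 0` and `K` such
that for EVERY such `δ` with `|δ|, ‖Dδ‖, ‖D²δ‖ ≤ κ`, every `μ` in the window, every root selection `u` of `{ε₀ + δ = μ}`, every scale `n`, every
`2πG` and EVERY offset `P₀`, the number of sector triples admitting `E`-shell momenta in the prescribed sectors with `|P₀ + k₂ + k₃ + k₄ - 2πG|_∞ ≤ c·π/2ⁿ`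
is `≤ K·2ⁿ·(n+1)` (`offsetSectorCount_perturbed_slack`; `offsetSectorCount_perturbed` = exact constraint). Ingredients: `cell_perturbed` (…PerturbedCell),
`card_grid_in_box_le_radial` (…PolarGridCount), `abs_hfunE_le_of_sum` (this file), `countPairs_perturbed` (…PerturbedCountPairs). Everything is PROVED;
no definitions. References: BGM 2006 Lemma 3.1, (2.76), (2.80), App. A2–A3 [cite: BenfattoGiulianiMastropietro2006]; HOME/prover-p4/PORT-NOTE.md.
-/

noncomputable section

namespace Summit.HubbardSuperconductivity.HubbardSuperconductivity.Theorems.PerturbedFermiCurve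

set_option linter.dupNamespace false -- summit = problem name (single-conjunct summit), D-0017

open Classical
open Real Set
open Literature.MathematicalPhysics.QuantumLattice Literature.MathematicalPhysics.QuantumLattice.BandSectorCounting

/-! ## From the sum condition to the perturbed offset level function -/

/-- **From the sum condition to the perturbed offset level function**: if `δ` is `2πℤ²`-periodic and even with `‖Dδ‖ ≤ κ₁`, `u` is a root
selection of `{ε₀ + δ = μ}`, and the curve point `p_E(θ₄)` completes `P + p_E(θ₂) + p_E(θ₃)` to `2πG` within `r` (coordinatewise), then
`|h^E_P(θ₂, θ₃)| ≤ (4 + κ₁) r`. (The lineage's `abs_hfunP_le_of_sum` on the moving curve.) [folklore] -/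
theorem abs_hfunE_le_of_sum {δ : (Fin 2 → ℝ) → ℝ} (hδs : ContDiff ℝ 2 δ) (heven : ∀ k, δ (-k) = δ k)
    (hper : ∀ (k : Fin 2 → ℝ) (m : Fin 2 → ℤ), δ (fun i => k i + 2 * π * m i) = δ k)
    {κ₁ μ : ℝ} (hκ : ∀ k : Fin 2 → ℝ, ‖fderiv ℝ δ k‖ ≤ κ₁) {u : ℝ → ℝ}
    (hu : ∀ θ, IsBandFermiRadius (μ - δ (u θ • dir θ)) θ (u θ)) {P : ℝ × ℝ} {θ₂ θ₃ θ₄ r : ℝ} {G₀ G₁ : ℤ}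
    (hx : |P.1 + u θ₂ * Real.cos θ₂ + u θ₃ * Real.cos θ₃ + u θ₄ * Real.cos θ₄ - 2 * π * G₀| ≤ r)
    (hy : |P.2 + u θ₂ * Real.sin θ₂ + u θ₃ * Real.sin θ₃ + u θ₄ * Real.sin θ₄ - 2 * π * G₁| ≤ r) :
    |hfunE δ u μ P θ₂ θ₃| ≤ (4 + κ₁) * r := by
  have h2ne : (2 : WithTop ℕ∞) ≠ 0 := by norm_num
  set e₀ := P.1 + u θ₂ * Real.cos θ₂ + u θ₃ * Real.cos θ₃ + u θ₄ * Real.cos θ₄ - 2 * π * G₀ with he₀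
  set e₁ := P.2 + u θ₂ * Real.sin θ₂ + u θ₃ * Real.sin θ₃ + u θ₄ * Real.sin θ₄ - 2 * π * G₁ with he₁
  have hr : 0 ≤ r := (abs_nonneg _).trans hx; have hκ₁0 : 0 ≤ κ₁ := (norm_nonneg _).trans (hκ 0)
  have hSX : SXE u P θ₂ θ₃ = (-(u θ₄ * Real.cos θ₄) + e₀) - (-G₀ : ℤ) * (2 * π) := by
    unfold SXE XE; rw [he₀]; push_cast; ring
  have hSY : SYE u P θ₂ θ₃ = (-(u θ₄ * Real.sin θ₄) + e₁) - (-G₁ : ℤ) * (2 * π) := by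
    unfold SYE YE; rw [he₁]; push_cast; ring
  have hmom : momE u P θ₂ θ₃ = fun i => (![u θ₄ * Real.cos θ₄ - e₀, u θ₄ * Real.sin θ₄ - e₁] : Fin 2 → ℝ) i * (-1) +
      2 * π * ((![G₀, G₁] : Fin 2 → ℤ) i : ℝ) := by
    ext i; fin_cases i
    · simp [momE, hSX]; ring
    · simp [momE, hSY]; ring
  have hδS : δ (momE u P θ₂ θ₃) = δ ![u θ₄ * Real.cos θ₄ - e₀, u θ₄ * Real.sin θ₄ - e₁] := by
    rw [hmom]
    have h1 := hper (fun i => (![u θ₄ * Real.cos θ₄ - e₀, u θ₄ * Real.sin θ₄ - e₁] : Fin 2 → ℝ) i * (-1)) ![G₀, G₁]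
    rw [h1]
    have h2 : (fun i => (![u θ₄ * Real.cos θ₄ - e₀, u θ₄ * Real.sin θ₄ - e₁] : Fin 2 → ℝ) i * (-1)) =
        -(![u θ₄ * Real.cos θ₄ - e₀, u θ₄ * Real.sin θ₄ - e₁] : Fin 2 → ℝ) := by
      ext i; fin_cases i <;> simp
    rw [h2, heven]
  have hp₄ : u θ₄ • dir θ₄ = ![u θ₄ * Real.cos θ₄, u θ₄ * Real.sin θ₄] := by
    ext i; fin_cases i <;> simp [dir]
  have hroot : eps2 (u θ₄ * Real.cos θ₄) (u θ₄ * Real.sin θ₄) + δ ![u θ₄ * Real.cos θ₄, u θ₄ * Real.sin θ₄] = μ := by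
    have h := ((isBandFermiRadius_shifted_iff δ μ θ₄ (u θ₄)).1 (hu θ₄)).2
    rw [hp₄, sqDispersion_eq_eps2] at h
    simpa using h
  have hdiffδ : ∀ k : Fin 2 → ℝ, DifferentiableAt ℝ δ k := fun k => (hδs.differentiable h2ne) k
  have hLipδ : |δ ![u θ₄ * Real.cos θ₄ - e₀, u θ₄ * Real.sin θ₄ - e₁] - δ ![u θ₄ * Real.cos θ₄, u θ₄ * Real.sin θ₄]| ≤ κ₁ * r := by
    have h := (convex_univ (𝕜 := ℝ) (E := Fin 2 → ℝ)).norm_image_sub_le_of_norm_fderiv_le (fun k _ => hdiffδ k) (fun k _ => hκ k)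
      (mem_univ ![u θ₄ * Real.cos θ₄, u θ₄ * Real.sin θ₄]) (mem_univ ![u θ₄ * Real.cos θ₄ - e₀, u θ₄ * Real.sin θ₄ - e₁])
    rw [Real.norm_eq_abs] at h
    refine h.trans (mul_le_mul_of_nonneg_left ?_ hκ₁0)
    have e : (![u θ₄ * Real.cos θ₄ - e₀, u θ₄ * Real.sin θ₄ - e₁] : Fin 2 → ℝ) - ![u θ₄ * Real.cos θ₄, u θ₄ * Real.sin θ₄] = ![-e₀, -e₁] := by
      ext i; fin_cases i <;> simp
    rw [e]
    exact norm_vec2_le hr (by rw [abs_neg]; exact hx) (by rw [abs_neg]; exact hy)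
  have hLipε : |eps2 (u θ₄ * Real.cos θ₄ - e₀) (u θ₄ * Real.sin θ₄ - e₁) - eps2 (u θ₄ * Real.cos θ₄) (u θ₄ * Real.sin θ₄)| ≤ 4 * r := by
    refine (abs_eps2_sub_eps2_le _ _ _ _).trans ?_
    rw [show u θ₄ * Real.cos θ₄ - e₀ - u θ₄ * Real.cos θ₄ = -e₀ by ring, show u θ₄ * Real.sin θ₄ - e₁ - u θ₄ * Real.sin θ₄ = -e₁ by ring,
      abs_neg, abs_neg]
    linarith
  -- assemble
  unfold hfunE
  rw [hSX, hSY, eps2_sub_int_mul, hδS,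
    show -(u θ₄ * Real.cos θ₄) + e₀ = -(u θ₄ * Real.cos θ₄ - e₀) by ring, show -(u θ₄ * Real.sin θ₄) + e₁ = -(u θ₄ * Real.sin θ₄ - e₁) by ring,
    eps2_neg]
  have hid : eps2 (u θ₄ * Real.cos θ₄ - e₀) (u θ₄ * Real.sin θ₄ - e₁) + δ ![u θ₄ * Real.cos θ₄ - e₀, u θ₄ * Real.sin θ₄ - e₁] - μ =
      (eps2 (u θ₄ * Real.cos θ₄ - e₀) (u θ₄ * Real.sin θ₄ - e₁) - eps2 (u θ₄ * Real.cos θ₄) (u θ₄ * Real.sin θ₄)) +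
        (δ ![u θ₄ * Real.cos θ₄ - e₀, u θ₄ * Real.sin θ₄ - e₁] - δ ![u θ₄ * Real.cos θ₄, u θ₄ * Real.sin θ₄]) := by
    linarith [hroot]
  rw [hid]
  refine (abs_add_le _ _).trans ?_
  linarith

/-! ## Cor. F.3 on the moving curve -/

/-- **The sector count against an arbitrary momentum offset KNOWN UP TO `c·w`, modulo `2πℤ²`, ON THE PERTURBED FERMI CURVE** (DECOMP App. F
Cor. F.3 = BGM 2006 (2.76)/(2.80) for ALL numbers of legs, for the `E`-shells of the moving curve `{ε₀ + δ = μ}` at every scale): for every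
level window `[μ₁, μ₂] ⊂ (-4, 0)` and slack `c ≥ 0` there are `κ > 0` and `K` such that for every `C²`, even, `2πℤ²`-periodic `δ` with
`|δ|, ‖Dδ‖, ‖D²δ‖ ≤ κ` on `ℝ²`, every `μ ∈ [μ₁, μ₂]`, every root selection `u`, every `P₀ ∈ ℝ²`, every reciprocal vector `2πG` and every `n`,
the number of sector triples `(ω₂, ω₃, ω₄)` of angular width `w = π/2ⁿ` for which momenta of the `E`-shell `|ε₀ + δ - μ| ≤ w` in the prescribed
sectors can satisfy `|P₀ + k₂ + k₃ + k₄ - 2πG|_∞ ≤ c·w` is at most `K·2ⁿ·(n+1)` — `K`, `κ` INDEPENDENT of `δ`, `u`, `P₀`, `G`, `μ`. Proof: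
perturbed cell geometry for the three legs (`cell_perturbed`, radius `≤ 2D_cell w` for `κ ≤ Dt_min/2`), elimination of the last leg on the radial
graph (`card_prod3_le`, `card_grid_in_box_le_radial`), `|h^E_{P₀}| ≤ 5(6D_cell + c) w` (`abs_hfunE_le_of_sum`, `κ ≤ 1`), and the uniform
two-dimensional count `countPairs_perturbed`. [cite: BenfattoGiulianiMastropietro2006, Lemma 3.1 / (2.76) / (2.80) / App. A3] -/
theorem offsetSectorCount_perturbed_slack :
    ∀ μ₁ μ₂ cS : ℝ, -4 < μ₁ → μ₁ ≤ μ₂ → μ₂ < 0 → 0 ≤ cS → ∃ κ : ℝ, 0 < κ ∧ ∃ K : ℝ, 0 < K ∧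
      ∀ δ : (Fin 2 → ℝ) → ℝ, ContDiff ℝ 2 δ → (∀ k, δ (-k) = δ k) → (∀ (k : Fin 2 → ℝ) (m : Fin 2 → ℤ), δ (fun i => k i + 2 * π * m i) = δ k) →
        (∀ k : Fin 2 → ℝ, |δ k| ≤ κ) → (∀ k : Fin 2 → ℝ, ‖fderiv ℝ δ k‖ ≤ κ) → (∀ k : Fin 2 → ℝ, ‖fderiv ℝ (fderiv ℝ δ) k‖ ≤ κ) →
      ∀ μ ∈ Set.Icc μ₁ μ₂, ∀ u : ℝ → ℝ, (∀ θ, IsBandFermiRadius (μ - δ (u θ • dir θ)) θ (u θ)) →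
      ∀ (n : ℕ) (G : Fin 2 → ℤ) (P₀ : Fin 2 → ℝ),
      (((Finset.univ : Finset (Fin (sectorCount n) × Fin (sectorCount n) × Fin (sectorCount n))).filter (fun ω : Fin (sectorCount n) × Fin (sectorCount n) × Fin (sectorCount n) =>
        ∃ k : Fin 3 → Fin 2 → ℝ, (∀ j i, |k j i| ≤ Real.pi) ∧ (∀ j, |sqDispersion (k j) + δ (k j) - μ| ≤ sectorWidth n) ∧
          sectorIndex n (Complex.arg (⟨k 0 0, k 0 1⟩ : ℂ)) = (ω.1 : ℕ) ∧
          sectorIndex n (Complex.arg (⟨k 1 0, k 1 1⟩ : ℂ)) = (ω.2.1 : ℕ) ∧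
          sectorIndex n (Complex.arg (⟨k 2 0, k 2 1⟩ : ℂ)) = (ω.2.2 : ℕ) ∧
          (∀ i, |P₀ i + ∑ j, k j i - 2 * Real.pi * (G i : ℝ)| ≤ cS * sectorWidth n))).card : ℝ) ≤ K * 2 ^ n * ((n : ℝ) + 1) := by
  intro μ₁ μ₂ cS hμ₁ h12 hμ₂ hc
  -- the level range `[a', b']` and its uniform bounds
  have ha : -4 < (μ₁ - 4) / 2 := by linarith
  have hab : (μ₁ - 4) / 2 ≤ μ₂ / 2 := by linarith
  have hb : μ₂ / 2 < 0 := by linarith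
  obtain ⟨B, -⟩ : ∃ B : BandBounds ((μ₁ - 4) / 2) (μ₂ / 2), B = bandBounds ha hab hb := ⟨_, rfl⟩
  set m₀ := min (μ₁ - (μ₁ - 4) / 2) (μ₂ / 2 - μ₂) with hm₀def
  have hm₀ : 0 < m₀ := lt_min (by linarith) (by linarith)
  have hm1 : m₀ ≤ μ₁ - (μ₁ - 4) / 2 := min_le_left _ _; have hm2 : m₀ ≤ μ₂ / 2 - μ₂ := min_le_right _ _
  have hD := B.Dcell_pos; have hDt := B.Dtmin_pos; have hum := B.umin_pos; have hs := B.smax_pos; have hπ := Real.pi_pos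
  have hCδ : 0 < 5 * (3 * (2 * B.Dcell) + cS) := by positivity
  obtain ⟨κp, hκp, Kp, hKp, hcount⟩ := countPairs_perturbed ((μ₁ - 4) / 2) (μ₂ / 2) ha hab hb (m₀ / 2) (5 * (3 * (2 * B.Dcell) + cS))
    (by positivity) hCδ
  -- the perturbation size, the threshold on `w` and the constants
  set κ := min κp (min 1 (min (B.Dtmin / 2) (m₀ / 4))) with hκdef
  have hκ0 : 0 < κ := lt_min hκp (lt_min one_pos (lt_min (by positivity) (by positivity)))
  have hκp' : κ ≤ κp := min_le_left _ _; have hκ1 : κ ≤ 1 := (min_le_right _ _).trans (min_le_left _ _)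
  have hκD : κ ≤ B.Dtmin / 2 := (min_le_right _ _).trans ((min_le_right _ _).trans (min_le_left _ _))
  have hκm : κ ≤ m₀ / 4 := (min_le_right _ _).trans ((min_le_right _ _).trans (min_le_right _ _)); have hκDt : κ < B.Dtmin := by linarith
  obtain ⟨w₀, hw₀⟩ : ∃ w₀ : ℝ, w₀ = min 1 (min (m₀ / 4) ((m₀ / 4) / (5 * (3 * (2 * B.Dcell) + cS)))) := ⟨_, rfl⟩
  have hw₀pos : 0 < w₀ := by rw [hw₀]; exact lt_min (by norm_num) (lt_min (by positivity) (by positivity))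
  obtain ⟨C₀, hC₀⟩ : ∃ C₀ : ℝ, C₀ = 3 * (2 * (π * (Real.sqrt 2 * (3 * (2 * B.Dcell) + cS) / B.umin)) + 1) := ⟨_, rfl⟩
  have hC₀pos : 0 < C₀ := by rw [hC₀]; positivity
  obtain ⟨K₁, hK₁⟩ : ∃ K₁ : ℝ, K₁ = 8 * (π / w₀) ^ 2 := ⟨_, rfl⟩
  obtain ⟨K₂, hK₂⟩ : ∃ K₂ : ℝ, K₂ = C₀ * Kp * 3 / π := ⟨_, rfl⟩
  have hK₁pos : 0 < K₁ := (by rw [hK₁]; positivity); have hK₂pos : 0 < K₂ := (by rw [hK₂]; positivity)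
  refine ⟨κ, hκ0, K₁ + K₂, by positivity, ?_⟩
  intro δ hδs heven hper hδ hκ' hκ₂ μ hμ u hu n G P₀
  have h2ne : (2 : WithTop ℕ∞) ≠ 0 := by norm_num
  have hwpos : 0 < sectorWidth n := sectorWidth_pos n; have hNw : (sectorCount n : ℝ) * sectorWidth n = 2 * π := sectorCount_mul_sectorWidth n
  have h2n : (2 : ℝ) ^ n * sectorWidth n = π := by rw [sectorWidth]; field_simp
  have hNeq : sectorCount n = 2 * 2 ^ n := (by unfold sectorCount; ring)
  have hNreal : (sectorCount n : ℝ) = 2 * 2 ^ n := (by rw [hNeq]; push_cast; ring)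
  have hsc : ∀ i : ℕ, sectorCenter n i = sectorWidth n / 2 + i * sectorWidth n := BandSectorCounting.sectorCenter_eq n
  have hcen : ∀ φ : ℝ, ∃ m : ℤ, |φ + m * (2 * π) - sectorCenter n (sectorIndex n φ)| ≤ sectorWidth n / 2 := by
    intro φ
    obtain ⟨m, hm⟩ := exists_angleRep_eq_add φ
    refine ⟨m, ?_⟩
    rw [← hm]; exact abs_angleRep_sub_sectorCenter_le n φ
  generalize hwdef : sectorWidth n = w at hwpos hNw h2n hsc hcen ⊢
  have hμab : μ ∈ Icc ((μ₁ - 4) / 2) (μ₂ / 2) := ⟨by linarith only [hμ.1, hμ₁], by linarith only [hμ.2, hμ₂]⟩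
  have h2npos : (0 : ℝ) < 2 ^ n := by positivity
  set P : ℝ × ℝ := (P₀ 0, P₀ 1) with hPdef
  -- square-restricted forms of the perturbation hypotheses
  have hδsq : ∀ k : Fin 2 → ℝ, (∀ i, |k i| ≤ π) → |δ k| ≤ κ := fun k _ => hδ k
  have hdsq : ∀ k : Fin 2 → ℝ, (∀ i, |k i| ≤ π) → DifferentiableAt ℝ δ k := fun k _ => (hδs.differentiable h2ne) k
  have hκsq : ∀ k : Fin 2 → ℝ, (∀ i, |k i| ≤ π) → ‖fderiv ℝ δ k‖ ≤ κ := fun k _ => hκ' k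
  have hLip : ∀ k k' : Fin 2 → ℝ, (∀ i, |k i| ≤ π) → (∀ i, |k' i| ≤ π) → |δ k - δ k'| ≤ κ * ‖k - k'‖ :=
    fun k k' hk hk' => lipschitz_of_fderiv_le hdsq hκsq hk hk'
  -- the trivial bound `N³`
  have htriv : ∀ (pr : Fin (sectorCount n) × Fin (sectorCount n) × Fin (sectorCount n) → Prop) [DecidablePred pr],
      ((((Finset.univ : Finset (Fin (sectorCount n) × Fin (sectorCount n) × Fin (sectorCount n))).filter pr).card : ℝ)) ≤ (sectorCount n : ℝ) ^ 3 := by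
    intro pr _
    have h1 := Finset.card_filter_le (Finset.univ : Finset (Fin (sectorCount n) × Fin (sectorCount n) × Fin (sectorCount n))) pr
    rw [Finset.card_univ, Fintype.card_prod, Fintype.card_prod, Fintype.card_fin] at h1
    have : ((((Finset.univ : Finset (Fin (sectorCount n) × Fin (sectorCount n) × Fin (sectorCount n))).filter pr).card : ℝ)) ≤
        ((sectorCount n * (sectorCount n * sectorCount n) : ℕ) : ℝ) := by exact_mod_cast h1
    calc _ ≤ ((sectorCount n * (sectorCount n * sectorCount n) : ℕ) : ℝ) := this
      _ = (sectorCount n : ℝ) ^ 3 := by push_cast; ring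
  by_cases hwle : w ≤ w₀
  · -- the main case
    have hw1 : w ≤ 1 := hwle.trans (by rw [hw₀]; exact min_le_left _ _)
    have hwm : w ≤ m₀ / 4 := hwle.trans (by rw [hw₀]; exact (min_le_right _ _).trans (min_le_left _ _))
    have hwη : w ≤ (m₀ / 4) / (5 * (3 * (2 * B.Dcell) + cS)) := hwle.trans (by rw [hw₀]; exact (min_le_right _ _).trans (min_le_right _ _))
    have h2δ : 5 * (3 * (2 * B.Dcell) + cS) * w ≤ m₀ / 2 / 2 := by
      have := mul_le_mul_of_nonneg_left hwη hCδ.le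
      have e : 5 * (3 * (2 * B.Dcell) + cS) * ((m₀ / 4) / (5 * (3 * (2 * B.Dcell) + cS))) = m₀ / 4 := by field_simp
      rw [e] at this; linarith only [this]
    have hlo : (μ₁ - 4) / 2 ≤ μ - κ - w := by linarith only [hμ.1, hm1, hκm, hwm, hm₀]
    have hhi : μ + κ + w ≤ μ₂ / 2 := by linarith only [hμ.2, hm2, hκm, hwm, hm₀]
    have hlo' : (μ₁ - 4) / 2 ≤ μ - κ := (by linarith only [hlo, hwpos]); have hhi' : μ + κ ≤ μ₂ / 2 := (by linarith only [hhi, hwpos])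
    have hlop : (μ₁ - 4) / 2 ≤ μ - m₀ / 2 := (by linarith only [hμ.1, hm1, hm₀])
    have hhip : μ + m₀ / 2 ≤ μ₂ / 2 := (by linarith only [hμ.2, hm2, hm₀])
    -- the perturbed cell radius is at most `2 D_cell w`
    have hrad : (w + B.smax * B.Dtmin * (w / 2)) / (B.Dtmin - κ) ≤ 2 * B.Dcell * w := by
      rw [div_le_iff₀ (sub_pos.2 hκDt)]
      unfold BandBounds.Dcell
      have e : 2 * (1 / B.Dtmin + B.smax / 2) * w * (B.Dtmin - κ) =
          (w + B.smax * B.Dtmin * (w / 2)) + (w + B.smax * B.Dtmin * (w / 2)) * (1 - 2 * κ / B.Dtmin) := by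
        field_simp; ring
      rw [e]
      have h1 : 0 ≤ 1 - 2 * κ / B.Dtmin := by
        rw [sub_nonneg, div_le_one hDt]; linarith only [hκD]
      have h2 : 0 ≤ w + B.smax * B.Dtmin * (w / 2) := by positivity
      nlinarith only [h1, h2]
    -- Step 1: the admissible triples have their centre sums close to `2πG - P₀`
    have hsub : (Finset.univ : Finset (Fin (sectorCount n) × Fin (sectorCount n) × Fin (sectorCount n))).filter (fun ω : Fin (sectorCount n) × Fin (sectorCount n) × Fin (sectorCount n) =>
        ∃ k : Fin 3 → Fin 2 → ℝ, (∀ j i, |k j i| ≤ Real.pi) ∧ (∀ j, |sqDispersion (k j) + δ (k j) - μ| ≤ w) ∧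
          sectorIndex n (Complex.arg (⟨k 0 0, k 0 1⟩ : ℂ)) = (ω.1 : ℕ) ∧
          sectorIndex n (Complex.arg (⟨k 1 0, k 1 1⟩ : ℂ)) = (ω.2.1 : ℕ) ∧
          sectorIndex n (Complex.arg (⟨k 2 0, k 2 1⟩ : ℂ)) = (ω.2.2 : ℕ) ∧ (∀ i, |P₀ i + ∑ j, k j i - 2 * Real.pi * (G i : ℝ)| ≤ cS * w)) ⊆
      (Finset.univ : Finset (Fin (sectorCount n) × Fin (sectorCount n) × Fin (sectorCount n))).filter (fun ω : Fin (sectorCount n) × Fin (sectorCount n) × Fin (sectorCount n) =>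
        |P.1 + u (w / 2 + ((ω.1 : ℕ) : ℝ) * w) * Real.cos (w / 2 + ((ω.1 : ℕ) : ℝ) * w) +
            u (w / 2 + ((ω.2.1 : ℕ) : ℝ) * w) * Real.cos (w / 2 + ((ω.2.1 : ℕ) : ℝ) * w) +
            u (w / 2 + ((ω.2.2 : ℕ) : ℝ) * w) * Real.cos (w / 2 + ((ω.2.2 : ℕ) : ℝ) * w) - 2 * π * (G 0 : ℝ)| ≤ (3 * (2 * B.Dcell) + cS) * w ∧
        |P.2 + u (w / 2 + ((ω.1 : ℕ) : ℝ) * w) * Real.sin (w / 2 + ((ω.1 : ℕ) : ℝ) * w) +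
            u (w / 2 + ((ω.2.1 : ℕ) : ℝ) * w) * Real.sin (w / 2 + ((ω.2.1 : ℕ) : ℝ) * w) +
            u (w / 2 + ((ω.2.2 : ℕ) : ℝ) * w) * Real.sin (w / 2 + ((ω.2.2 : ℕ) : ℝ) * w) - 2 * π * (G 1 : ℝ)| ≤ (3 * (2 * B.Dcell) + cS) * w) := by
      intro ω hω
      rw [Finset.mem_filter] at hω
      obtain ⟨-, k, hk, hsh, hi0, hi1, hi2, hsum⟩ := hω
      -- the perturbed cells of the three legs
      have hcell : ∀ j : Fin 3, ∀ ωj : ℕ, sectorIndex n (Complex.arg (⟨k j 0, k j 1⟩ : ℂ)) = ωj → ∀ i : Fin 2,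
          |k j i - (u (w / 2 + (ωj : ℝ) * w) • dir (w / 2 + (ωj : ℝ) * w)) i| ≤ 2 * B.Dcell * w := by
        intro j ωj hωj i
        obtain ⟨m, hm⟩ := hcen (Complex.arg (⟨k j 0, k j 1⟩ : ℂ))
        rw [hωj, hsc] at hm
        exact (cell_perturbed B hδsq hLip hκDt hu (hk j) (hsh j) hlo hhi hm i).trans hrad
      have c00 := hcell 0 _ hi0 0; have c01 := hcell 0 _ hi0 1; have c10 := hcell 1 _ hi1 0; have c11 := hcell 1 _ hi1 1
      have c20 := hcell 2 _ hi2 0; have c21 := hcell 2 _ hi2 1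
      simp only [Pi.smul_apply, smul_eq_mul, dir_zero, dir_one] at c00 c01 c10 c11 c20 c21
      rw [Finset.mem_filter]
      refine ⟨Finset.mem_univ _, ?_, ?_⟩
      · have hs0 := hsum 0
        rw [Fin.sum_univ_three] at hs0
        have e : P.1 + u (w / 2 + ((ω.1 : ℕ) : ℝ) * w) * Real.cos (w / 2 + ((ω.1 : ℕ) : ℝ) * w) +
            u (w / 2 + ((ω.2.1 : ℕ) : ℝ) * w) * Real.cos (w / 2 + ((ω.2.1 : ℕ) : ℝ) * w) +
            u (w / 2 + ((ω.2.2 : ℕ) : ℝ) * w) * Real.cos (w / 2 + ((ω.2.2 : ℕ) : ℝ) * w) - 2 * π * (G 0 : ℝ) =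
            (P₀ 0 + (k 0 0 + k 1 0 + k 2 0) - 2 * Real.pi * (G 0 : ℝ)) +
            (-(k 0 0 - u (w / 2 + ((ω.1 : ℕ) : ℝ) * w) * Real.cos (w / 2 + ((ω.1 : ℕ) : ℝ) * w)) +
             -(k 1 0 - u (w / 2 + ((ω.2.1 : ℕ) : ℝ) * w) * Real.cos (w / 2 + ((ω.2.1 : ℕ) : ℝ) * w)) +
             -(k 2 0 - u (w / 2 + ((ω.2.2 : ℕ) : ℝ) * w) * Real.cos (w / 2 + ((ω.2.2 : ℕ) : ℝ) * w))) := by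
          rw [hPdef]; ring
        rw [e]
        refine (abs_add_le _ _).trans ?_
        have t := abs_add_le (-(k 0 0 - u (w / 2 + ((ω.1 : ℕ) : ℝ) * w) * Real.cos (w / 2 + ((ω.1 : ℕ) : ℝ) * w)) +
             -(k 1 0 - u (w / 2 + ((ω.2.1 : ℕ) : ℝ) * w) * Real.cos (w / 2 + ((ω.2.1 : ℕ) : ℝ) * w)))
            (-(k 2 0 - u (w / 2 + ((ω.2.2 : ℕ) : ℝ) * w) * Real.cos (w / 2 + ((ω.2.2 : ℕ) : ℝ) * w)))
        have t' := abs_add_le (-(k 0 0 - u (w / 2 + ((ω.1 : ℕ) : ℝ) * w) * Real.cos (w / 2 + ((ω.1 : ℕ) : ℝ) * w)))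
             (-(k 1 0 - u (w / 2 + ((ω.2.1 : ℕ) : ℝ) * w) * Real.cos (w / 2 + ((ω.2.1 : ℕ) : ℝ) * w)))
        rw [abs_neg] at t t'; rw [abs_neg] at t'
        have t'' : |-(k 2 0 - u (w / 2 + ((ω.2.2 : ℕ) : ℝ) * w) * Real.cos (w / 2 + ((ω.2.2 : ℕ) : ℝ) * w))| ≤ 2 * B.Dcell * w := by
          rw [abs_neg]; exact c20
        linarith [c00, c10, hs0]
      · have hs1 := hsum 1
        rw [Fin.sum_univ_three] at hs1
        have e : P.2 + u (w / 2 + ((ω.1 : ℕ) : ℝ) * w) * Real.sin (w / 2 + ((ω.1 : ℕ) : ℝ) * w) +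
            u (w / 2 + ((ω.2.1 : ℕ) : ℝ) * w) * Real.sin (w / 2 + ((ω.2.1 : ℕ) : ℝ) * w) +
            u (w / 2 + ((ω.2.2 : ℕ) : ℝ) * w) * Real.sin (w / 2 + ((ω.2.2 : ℕ) : ℝ) * w) - 2 * π * (G 1 : ℝ) =
            (P₀ 1 + (k 0 1 + k 1 1 + k 2 1) - 2 * Real.pi * (G 1 : ℝ)) +
            (-(k 0 1 - u (w / 2 + ((ω.1 : ℕ) : ℝ) * w) * Real.sin (w / 2 + ((ω.1 : ℕ) : ℝ) * w)) +
             -(k 1 1 - u (w / 2 + ((ω.2.1 : ℕ) : ℝ) * w) * Real.sin (w / 2 + ((ω.2.1 : ℕ) : ℝ) * w)) +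
             -(k 2 1 - u (w / 2 + ((ω.2.2 : ℕ) : ℝ) * w) * Real.sin (w / 2 + ((ω.2.2 : ℕ) : ℝ) * w))) := by
          rw [hPdef]; ring
        rw [e]
        refine (abs_add_le _ _).trans ?_
        have t := abs_add_le (-(k 0 1 - u (w / 2 + ((ω.1 : ℕ) : ℝ) * w) * Real.sin (w / 2 + ((ω.1 : ℕ) : ℝ) * w)) +
             -(k 1 1 - u (w / 2 + ((ω.2.1 : ℕ) : ℝ) * w) * Real.sin (w / 2 + ((ω.2.1 : ℕ) : ℝ) * w)))
            (-(k 2 1 - u (w / 2 + ((ω.2.2 : ℕ) : ℝ) * w) * Real.sin (w / 2 + ((ω.2.2 : ℕ) : ℝ) * w)))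
        have t' := abs_add_le (-(k 0 1 - u (w / 2 + ((ω.1 : ℕ) : ℝ) * w) * Real.sin (w / 2 + ((ω.1 : ℕ) : ℝ) * w)))
             (-(k 1 1 - u (w / 2 + ((ω.2.1 : ℕ) : ℝ) * w) * Real.sin (w / 2 + ((ω.2.1 : ℕ) : ℝ) * w)))
        rw [abs_neg] at t t'; rw [abs_neg] at t'
        have t'' : |-(k 2 1 - u (w / 2 + ((ω.2.2 : ℕ) : ℝ) * w) * Real.sin (w / 2 + ((ω.2.2 : ℕ) : ℝ) * w))| ≤ 2 * B.Dcell * w := by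
          rw [abs_neg]; exact c21
        linarith [c01, c11, hs1]
    -- Step 2: eliminate the last index
    have hr : 0 ≤ (3 * (2 * B.Dcell) + cS) * w := by positivity
    have humin : ∀ θ, B.umin ≤ u θ := fun θ => umin_le_of_shifted B hδsq hlo' hhi' (hu θ)
    have hT'le : ((((Finset.univ : Finset (Fin (sectorCount n) × Fin (sectorCount n) × Fin (sectorCount n))).filter (fun ω : Fin (sectorCount n) × Fin (sectorCount n) × Fin (sectorCount n) =>
        |P.1 + u (w / 2 + ((ω.1 : ℕ) : ℝ) * w) * Real.cos (w / 2 + ((ω.1 : ℕ) : ℝ) * w) +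
            u (w / 2 + ((ω.2.1 : ℕ) : ℝ) * w) * Real.cos (w / 2 + ((ω.2.1 : ℕ) : ℝ) * w) +
            u (w / 2 + ((ω.2.2 : ℕ) : ℝ) * w) * Real.cos (w / 2 + ((ω.2.2 : ℕ) : ℝ) * w) - 2 * π * (G 0 : ℝ)| ≤ (3 * (2 * B.Dcell) + cS) * w ∧
        |P.2 + u (w / 2 + ((ω.1 : ℕ) : ℝ) * w) * Real.sin (w / 2 + ((ω.1 : ℕ) : ℝ) * w) +
            u (w / 2 + ((ω.2.1 : ℕ) : ℝ) * w) * Real.sin (w / 2 + ((ω.2.1 : ℕ) : ℝ) * w) +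
            u (w / 2 + ((ω.2.2 : ℕ) : ℝ) * w) * Real.sin (w / 2 + ((ω.2.2 : ℕ) : ℝ) * w) - 2 * π * (G 1 : ℝ)| ≤ (3 * (2 * B.Dcell) + cS) * w)).card : ℝ)) ≤
        C₀ * ((((Finset.range (sectorCount n) ×ˢ Finset.range (sectorCount n)).filter fun p : ℕ × ℕ =>
          |hfunE δ u μ P (w / 2 + p.1 * w) (w / 2 + p.2 * w)| ≤ 5 * (3 * (2 * B.Dcell) + cS) * w).card : ℝ)) := by
      refine card_prod3_le (N := sectorCount n)
        (Q := fun i c d => |P.1 + u (w / 2 + i * w) * Real.cos (w / 2 + i * w) + u (w / 2 + c * w) * Real.cos (w / 2 + c * w) +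
            u (w / 2 + d * w) * Real.cos (w / 2 + d * w) - 2 * π * (G 0 : ℝ)| ≤ (3 * (2 * B.Dcell) + cS) * w ∧
          |P.2 + u (w / 2 + i * w) * Real.sin (w / 2 + i * w) + u (w / 2 + c * w) * Real.sin (w / 2 + c * w) +
            u (w / 2 + d * w) * Real.sin (w / 2 + d * w) - 2 * π * (G 1 : ℝ)| ≤ (3 * (2 * B.Dcell) + cS) * w)
        (R := fun i c => |hfunE δ u μ P (w / 2 + i * w) (w / 2 + c * w)| ≤ 5 * (3 * (2 * B.Dcell) + cS) * w) hC₀pos.le ?_ ?_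
      · intro i c hi hc'
        have hbox := card_grid_in_box_le_radial (R := u) hum humin hwpos hNw hr (N := sectorCount n)
          (x := 2 * π * (G 0 : ℝ) - P.1 - u (w / 2 + i * w) * Real.cos (w / 2 + i * w) - u (w / 2 + c * w) * Real.cos (w / 2 + c * w))
          (y := 2 * π * (G 1 : ℝ) - P.2 - u (w / 2 + i * w) * Real.sin (w / 2 + i * w) - u (w / 2 + c * w) * Real.sin (w / 2 + c * w))
        have heq : ((Finset.range (sectorCount n)).filter fun d : ℕ =>
            |P.1 + u (w / 2 + i * w) * Real.cos (w / 2 + i * w) + u (w / 2 + c * w) * Real.cos (w / 2 + c * w) +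
              u (w / 2 + d * w) * Real.cos (w / 2 + d * w) - 2 * π * (G 0 : ℝ)| ≤ (3 * (2 * B.Dcell) + cS) * w ∧
            |P.2 + u (w / 2 + i * w) * Real.sin (w / 2 + i * w) + u (w / 2 + c * w) * Real.sin (w / 2 + c * w) +
              u (w / 2 + d * w) * Real.sin (w / 2 + d * w) - 2 * π * (G 1 : ℝ)| ≤ (3 * (2 * B.Dcell) + cS) * w) =
            ((Finset.range (sectorCount n)).filter fun d : ℕ =>
            |u (w / 2 + d * w) * Real.cos (w / 2 + d * w) -
                (2 * π * (G 0 : ℝ) - P.1 - u (w / 2 + i * w) * Real.cos (w / 2 + i * w) - u (w / 2 + c * w) * Real.cos (w / 2 + c * w))| ≤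
                (3 * (2 * B.Dcell) + cS) * w ∧
            |u (w / 2 + d * w) * Real.sin (w / 2 + d * w) -
                (2 * π * (G 1 : ℝ) - P.2 - u (w / 2 + i * w) * Real.sin (w / 2 + i * w) - u (w / 2 + c * w) * Real.sin (w / 2 + c * w))| ≤
                (3 * (2 * B.Dcell) + cS) * w) := by
          refine Finset.filter_congr fun d _ => ?_
          rw [show P.1 + u (w / 2 + i * w) * Real.cos (w / 2 + i * w) + u (w / 2 + c * w) * Real.cos (w / 2 + c * w) +
              u (w / 2 + d * w) * Real.cos (w / 2 + d * w) - 2 * π * (G 0 : ℝ) =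
            u (w / 2 + d * w) * Real.cos (w / 2 + d * w) -
                (2 * π * (G 0 : ℝ) - P.1 - u (w / 2 + i * w) * Real.cos (w / 2 + i * w) - u (w / 2 + c * w) * Real.cos (w / 2 + c * w)) by ring,
            show P.2 + u (w / 2 + i * w) * Real.sin (w / 2 + i * w) + u (w / 2 + c * w) * Real.sin (w / 2 + c * w) +
              u (w / 2 + d * w) * Real.sin (w / 2 + d * w) - 2 * π * (G 1 : ℝ) =
            u (w / 2 + d * w) * Real.sin (w / 2 + d * w) -
                (2 * π * (G 1 : ℝ) - P.2 - u (w / 2 + i * w) * Real.sin (w / 2 + i * w) - u (w / 2 + c * w) * Real.sin (w / 2 + c * w)) by ring]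
        rw [heq]
        refine hbox.trans (le_of_eq ?_)
        rw [hC₀]; field_simp
      · intro i c d hi hc' hd hQ
        have h := abs_hfunE_le_of_sum hδs heven hper hκ' hu hQ.1 hQ.2
        have hr' : 0 ≤ (3 * (2 * B.Dcell) + cS) * w := hr
        calc |hfunE δ u μ P (w / 2 + i * w) (w / 2 + c * w)| ≤ (4 + κ) * ((3 * (2 * B.Dcell) + cS) * w) := h
          _ ≤ 5 * ((3 * (2 * B.Dcell) + cS) * w) := mul_le_mul_of_nonneg_right (by linarith only [hκ1]) hr'
          _ = 5 * (3 * (2 * B.Dcell) + cS) * w := by ring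
    -- Step 3: the two-dimensional count on the moving curve, uniform in everything
    have hP := hcount δ hδs heven (fun k => (hδ k).trans hκp') (fun k => (hκ' k).trans hκp') (fun k => (hκ₂ k).trans hκp') μ hμab hlop hhip
      u hu P w (sectorCount n) (2 ^ n) n hwpos hw1 hNw (by push_cast; exact h2n) hNeq h2n h2δ
    clear hcount
    -- Step 4: arithmetic
    have hlogN : Real.log (sectorCount n : ℕ) ≤ (n : ℝ) + 1 := by rw [hNreal]; exact log_two_mul_two_pow_le n
    have hwinv : 1 / w = 2 ^ n / π := by rw [← h2n]; field_simp
    have e1 := Finset.card_le_card hsub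
    have e1' : ((((Finset.univ : Finset (Fin (sectorCount n) × Fin (sectorCount n) × Fin (sectorCount n))).filter (fun ω : Fin (sectorCount n) × Fin (sectorCount n) × Fin (sectorCount n) =>
        ∃ k : Fin 3 → Fin 2 → ℝ, (∀ j i, |k j i| ≤ Real.pi) ∧ (∀ j, |sqDispersion (k j) + δ (k j) - μ| ≤ w) ∧
          sectorIndex n (Complex.arg (⟨k 0 0, k 0 1⟩ : ℂ)) = (ω.1 : ℕ) ∧
          sectorIndex n (Complex.arg (⟨k 1 0, k 1 1⟩ : ℂ)) = (ω.2.1 : ℕ) ∧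
          sectorIndex n (Complex.arg (⟨k 2 0, k 2 1⟩ : ℂ)) = (ω.2.2 : ℕ) ∧ (∀ i, |P₀ i + ∑ j, k j i - 2 * Real.pi * (G i : ℝ)| ≤ cS * w))).card : ℝ)) ≤
        K₂ * 2 ^ n * ((n : ℝ) + 1) := by
      have e2 : Kp * ((n : ℝ) + 2 + Real.log (sectorCount n : ℕ)) / w ≤ Kp * (3 * ((n : ℝ) + 1)) / w := by
        apply div_le_div_of_nonneg_right _ hwpos.le
        apply mul_le_mul_of_nonneg_left _ hKp.le
        linarith only [hlogN]
      have e3 : Kp * (3 * ((n : ℝ) + 1)) / w = Kp * 3 / π * 2 ^ n * ((n : ℝ) + 1) := by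
        rw [div_eq_mul_one_div _ w, hwinv]; ring
      have e4 : C₀ * (Kp * 3 / π * 2 ^ n * ((n : ℝ) + 1)) = K₂ * 2 ^ n * ((n : ℝ) + 1) := by rw [hK₂]; ring
      calc _ ≤ _ := by exact_mod_cast e1
        _ ≤ C₀ * (Kp * ((n : ℝ) + 2 + Real.log (sectorCount n : ℕ)) / w) := hT'le.trans (mul_le_mul_of_nonneg_left hP hC₀pos.le)
        _ ≤ C₀ * (Kp * (3 * ((n : ℝ) + 1)) / w) := mul_le_mul_of_nonneg_left e2 hC₀pos.le
        _ = K₂ * 2 ^ n * ((n : ℝ) + 1) := by rw [e3, e4]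
    refine e1'.trans ?_
    have : 0 ≤ K₁ * 2 ^ n * ((n : ℝ) + 1) := by positivity
    linarith only [this]
  · -- small `n`: `2ⁿ < π / w₀`
    clear hcount
    push Not at hwle
    have h2nlt : (2 : ℝ) ^ n ≤ π / w₀ := by
      rw [le_div_iff₀ hw₀pos, ← h2n]
      exact mul_le_mul_of_nonneg_left hwle.le h2npos.le
    have hbound : (sectorCount n : ℝ) ^ 3 ≤ K₁ * 2 ^ n := by
      rw [hNreal, hK₁]
      have hsq : ((2 : ℝ) ^ n) ^ 2 ≤ (π / w₀) ^ 2 := pow_le_pow_left₀ h2npos.le h2nlt 2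
      have e : (2 * (2 : ℝ) ^ n) ^ 3 = 8 * ((2 : ℝ) ^ n) ^ 2 * 2 ^ n := by ring
      rw [e]
      exact mul_le_mul_of_nonneg_right (mul_le_mul_of_nonneg_left hsq (by norm_num)) h2npos.le
    refine (htriv _).trans (hbound.trans ?_)
    have h1 : K₁ * 2 ^ n ≤ (K₁ + K₂) * 2 ^ n := mul_le_mul_of_nonneg_right (by linarith only [hK₂pos]) h2npos.le
    have h2 : (K₁ + K₂) * 2 ^ n ≤ (K₁ + K₂) * 2 ^ n * ((n : ℝ) + 1) :=
      le_mul_of_one_le_right (by positivity) (by linarith only [(by positivity : (0:ℝ) ≤ n)])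
    linarith only [h1, h2]

/-- **Cor. F.3 on the moving curve, exact constraint** (`c = 0` of `offsetSectorCount_perturbed_slack`): the number of sector triples
admitting `E`-shell momenta with `P₀ + k₂ + k₃ + k₄ = 2πG` exactly is `≤ K·2ⁿ·(n+1)`, uniformly in `δ` (size `≤ κ`), `u`, `μ`, `P₀`, `G`.
[cite: BenfattoGiulianiMastropietro2006, Lemma 3.1 / (2.76) / (2.80) / App. A3] -/
theorem offsetSectorCount_perturbed :
    ∀ μ₁ μ₂ : ℝ, -4 < μ₁ → μ₁ ≤ μ₂ → μ₂ < 0 → ∃ κ : ℝ, 0 < κ ∧ ∃ K : ℝ, 0 < K ∧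
      ∀ δ : (Fin 2 → ℝ) → ℝ, ContDiff ℝ 2 δ → (∀ k, δ (-k) = δ k) → (∀ (k : Fin 2 → ℝ) (m : Fin 2 → ℤ), δ (fun i => k i + 2 * π * m i) = δ k) →
        (∀ k : Fin 2 → ℝ, |δ k| ≤ κ) → (∀ k : Fin 2 → ℝ, ‖fderiv ℝ δ k‖ ≤ κ) → (∀ k : Fin 2 → ℝ, ‖fderiv ℝ (fderiv ℝ δ) k‖ ≤ κ) →
      ∀ μ ∈ Set.Icc μ₁ μ₂, ∀ u : ℝ → ℝ, (∀ θ, IsBandFermiRadius (μ - δ (u θ • dir θ)) θ (u θ)) →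
      ∀ (n : ℕ) (G : Fin 2 → ℤ) (P₀ : Fin 2 → ℝ),
      (((Finset.univ : Finset (Fin (sectorCount n) × Fin (sectorCount n) × Fin (sectorCount n))).filter (fun ω : Fin (sectorCount n) × Fin (sectorCount n) × Fin (sectorCount n) =>
        ∃ k : Fin 3 → Fin 2 → ℝ, (∀ j i, |k j i| ≤ Real.pi) ∧ (∀ j, |sqDispersion (k j) + δ (k j) - μ| ≤ sectorWidth n) ∧
          sectorIndex n (Complex.arg (⟨k 0 0, k 0 1⟩ : ℂ)) = (ω.1 : ℕ) ∧
          sectorIndex n (Complex.arg (⟨k 1 0, k 1 1⟩ : ℂ)) = (ω.2.1 : ℕ) ∧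
          sectorIndex n (Complex.arg (⟨k 2 0, k 2 1⟩ : ℂ)) = (ω.2.2 : ℕ) ∧
          (∀ i, P₀ i + ∑ j, k j i = 2 * Real.pi * (G i : ℝ)))).card : ℝ) ≤ K * 2 ^ n * ((n : ℝ) + 1) := by
  intro μ₁ μ₂ hμ₁ h12 hμ₂
  obtain ⟨κ, hκ, K, hK, h⟩ := offsetSectorCount_perturbed_slack μ₁ μ₂ 0 hμ₁ h12 hμ₂ le_rfl
  refine ⟨κ, hκ, K, hK, fun δ hδs heven hper hδ hκ' hκ₂ μ hμ u hu n G P₀ => le_trans ?_ (h δ hδs heven hper hδ hκ' hκ₂ μ hμ u hu n G P₀)⟩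
  exact_mod_cast Finset.card_le_card (Finset.monotone_filter_right _ fun ω _ hω => by
    obtain ⟨k, hk, hsh, h0, h1, h2, hsum⟩ := hω
    exact ⟨k, hk, hsh, h0, h1, h2, fun i => by rw [hsum i, sub_self, abs_zero, zero_mul]⟩)

end Summit.HubbardSuperconductivity.HubbardSuperconductivity.Theorems.PerturbedFermiCurve

end
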